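import Summits.KontsevichZagierPeriods.KontsevichZagierPeriods.Theorems.LiouvilleUnfoldingAyoubPiLocalKernel
import Summits.KontsevichZagierPeriods.KontsevichZagierPeriods.Theorems.TerasomaMultiplicationBetaCancellationOfAyoubPiCancellation
import Literature.NumberTheory.Transcendental.KZCalculusProofs
import Literature.NumberTheory.Transcendental.KZSubcalculusInvariants

/-!
# `AyoubPiLocalKernel` (stmt-KontsevichZagierPeriods-0541) — negative knowledge: which moves a `[π]`-local certificate needs

The crux (`= KZ.PiLocalKernel`, Ayoub's Conjecture 7 for the four-move calculus) asks, for a pinned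
family `P n r = [unit disc] × r` and `c` with `KZ.eval c = 0`, for an iterate
`(lift (of ∘ P))^[N] c ∈ KZ.relations`. Two natural STRENGTHENINGS — the same conclusion inside a
SUB-calculus — are FALSE, by explicit value-`0` witnesses that the full calculus settles with `N = 0`:

* without the additivity moves (1a)+(1b) (`not_piLocalKernel_covNL`): witness `c = [ℝ⁰, 0]`; the
  invariant is `KZ.coeffSum`, preserved by rules (2)+(3) (`KZ.closure_cov_nl_le_ker_coeffSum`) and by
  `lift (of ∘ P)` (generators go to generators);
* without Newton–Leibniz (3) (`not_piLocalKernel_noNL`): witness `c = [ℝ⁰ × [0,1], 1] − [ℝ⁰, 1]`, ONE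
  printed rule-(3) move; the invariant is the dimension-graded evaluation (sum of the values of the
  dimension-`k` generators), preserved by (1a), (1b), (2) — which relate generators of one dimension
  and evaluate to `0` — and shifted by `2` in the grading by `lift (of ∘ P)`.
So every `[π]`-local certificate of a dimension-mixing identity contains printed rule (3), and every
certificate of a one-generator identity contains an additivity move: multiplying by discs replaces
neither. (Without change of variables (2) the question is left open here.)
[cite: KontsevichZagierPeriods2001, §1.2 rules (1)–(3)] [cite: Ayoub2014, Def. 6 and Conj. 7]
-/

noncomputable section

open MeasureTheory Set
open Literature.NumberTheory.Transcendental
open Literature.NumberTheory.Transcendental.KZ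

namespace Summit.KontsevichZagierPeriods.LiouvilleUnfolding.AyoubPiLocalKernelNegative.Subcalculi

open Summit.KontsevichZagierPeriods.KontsevichZagierPeriods.BetaCancellationLine
  (exists_pinned piRep_mul_sub_lift_mem_relations)

/-! ## Rules (2)+(3) alone: the coefficient sum obstructs -/

/-- `lift (of ∘ P)` sends generators to generators, so it preserves `KZ.coeffSum`. [folklore] -/
theorem coeffSum_lift (P : ∀ n : ℕ, IntegralRep n → IntegralRep (n + 2)) (c : FormalRep) :
    coeffSum (FreeAbelianGroup.lift (fun s : (Σ n, IntegralRep n) => of (P s.1 s.2)) c) =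
      coeffSum c := by
  induction c using FreeAbelianGroup.induction_on with
  | zero => simp
  | of s =>
    rw [FreeAbelianGroup.lift_apply_of, coeffSum_of]
    exact (FreeAbelianGroup.lift_apply_of _ _).symm
  | neg s ih => rw [map_neg, map_neg, map_neg, ih]
  | add x y hx hy => rw [map_add, map_add, map_add, hx, hy]

/-- … and so do its iterates. [folklore] -/
theorem coeffSum_lift_iterate (P : ∀ n : ℕ, IntegralRep n → IntegralRep (n + 2)) (N : ℕ)
    (c : FormalRep) :
    coeffSum ((⇑(FreeAbelianGroup.lift (fun s : (Σ n, IntegralRep n) => of (P s.1 s.2))))^[N] c) =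
      coeffSum c := by
  induction N with
  | zero => rfl
  | succ N ih => rw [Function.iterate_succ_apply', coeffSum_lift, ih]

/-- **Additivity is load-bearing even `[π]`-locally.** The crux with `KZ.relations` replaced by the
sub-calculus generated by change of variables (2) and Newton–Leibniz (3) is FALSE: for `c = [ℝ⁰, 0]`
(value `0`; a relation of the full calculus) every iterate `(lift (of ∘ P))^[N] c` is one generator,
of coefficient sum `1`, while rules (2)+(3) preserve the coefficient sum. [folklore] -/
theorem not_piLocalKernel_covNL :
    ¬ ∀ P : ∀ n : ℕ, IntegralRep n → IntegralRep (n + 2),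
      (∀ (n : ℕ) (r : IntegralRep n),
        (P n r).domain = {z : Fin (n + 2) → ℝ | z 0 ^ 2 + z 1 ^ 2 ≤ 1 ∧
            (fun i : Fin n => z i.succ.succ) ∈ r.domain} ∧
          (P n r).integrand = fun z => r.integrand (fun i : Fin n => z i.succ.succ)) →
      ∀ c : FormalRep, eval c = 0 → ∃ N : ℕ,
        (⇑(FreeAbelianGroup.lift (fun s : (Σ n, IntegralRep n) => of (P s.1 s.2))))^[N] c ∈
          AddSubgroup.closure (changeOfVariablesRel ∪ newtonLeibnizRel) := by
  intro h
  obtain ⟨P, hP⟩ := exists_pinned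
  -- the witness `[ℝ⁰, 0]`
  let z : IntegralRep 0 := IntegralRep.ofRational univ 0 1
    Literature.ModelTheory.ExponentialFields.isSemialgebraic_univ (fun _ _ => by simp) (by simp)
  have h0 : eval (of z) = 0 := by
    rw [eval_of]
    simp [z, IntegralRep.value_ofRational]
  obtain ⟨N, hN⟩ := h P hP _ h0
  have h1 : coeffSum ((⇑(FreeAbelianGroup.lift
      (fun s : (Σ n, IntegralRep n) => of (P s.1 s.2))))^[N] (of z)) = 0 :=
    closure_cov_nl_le_ker_coeffSum hN
  rw [coeffSum_lift_iterate, coeffSum_of] at h1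
  exact one_ne_zero h1

/-! ## Rules (1a)+(1b)+(2) alone: the dimension grading obstructs -/

/-- The dimension-graded evaluation on a generator. [folklore] -/
theorem gradedEval_of (k : ℕ) {n : ℕ} (r : IntegralRep n) :
    FreeAbelianGroup.lift (fun s : (Σ n, IntegralRep n) => if s.1 = k then s.2.value else (0 : ℝ))
      (of r) = if n = k then r.value else 0 :=
  FreeAbelianGroup.lift_apply_of _ _

/-- Rules (1a), (1b), (2) preserve the dimension-graded evaluation: each relates generators of ONE
dimension and evaluates to `0` (soundness, `KZ.eval_eq_zero_of_mem_*_holds`). [folklore] -/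
theorem closure_noNL_le_ker_gradedEval (k : ℕ) :
    AddSubgroup.closure (domainAddRel ∪ integrandAddRel ∪ changeOfVariablesRel) ≤
      (FreeAbelianGroup.lift
        (fun s : (Σ n, IntegralRep n) => if s.1 = k then s.2.value else (0 : ℝ))).ker := by
  refine (AddSubgroup.closure_le _).mpr ?_
  rintro c ((hc | hc) | hc)
  · have h0 : eval c = 0 := eval_eq_zero_of_mem_domainAddRel_holds hc
    obtain ⟨n, r, r₁, r₂, -, -, -, -, rfl⟩ := hc
    change FreeAbelianGroup.lift _ _ = 0
    simp only [map_sub, eval_of, gradedEval_of] at h0 ⊢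
    split_ifs
    · exact h0
    · simp
  · have h0 : eval c = 0 := eval_eq_zero_of_mem_integrandAddRel_holds hc
    obtain ⟨n, r, r₁, r₂, -, -, -, rfl⟩ := hc
    change FreeAbelianGroup.lift _ _ = 0
    simp only [map_sub, eval_of, gradedEval_of] at h0 ⊢
    split_ifs
    · exact h0
    · simp
  · have h0 : eval c = 0 := eval_eq_zero_of_mem_changeOfVariablesRel_holds hc
    obtain ⟨n, r, r', Φ, Φ', -, -, -, -, -, rfl⟩ := hc
    change FreeAbelianGroup.lift _ _ = 0
    simp only [map_sub, eval_of, gradedEval_of] at h0 ⊢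
    split_ifs
    · exact h0
    · simp

/-- The value of a pinned multiple: `value (P n r) = π · value r` (from `[π] * [r] ≡ [P r]`,
soundness and Fubini). [folklore] -/
theorem value_pinned (P : ∀ n : ℕ, IntegralRep n → IntegralRep (n + 2))
    (hP : ∀ (n : ℕ) (r : IntegralRep n),
      (P n r).domain = {z : Fin (n + 2) → ℝ | z 0 ^ 2 + z 1 ^ 2 ≤ 1 ∧
          (fun i : Fin n => z i.succ.succ) ∈ r.domain} ∧
        (P n r).integrand = fun z => r.integrand (fun i : Fin n => z i.succ.succ))
    {n : ℕ} (r : IntegralRep n) : (P n r).value = Real.pi * r.value := by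
  have h0 : eval (of piRep * of r -
      FreeAbelianGroup.lift (fun s : (Σ n, IntegralRep n) => of (P s.1 s.2)) (of r)) = 0 :=
    relations_le_ker_eval_holds (piRep_mul_sub_lift_mem_relations P hP (of r))
  rw [map_sub, eval_piRep_mul, sub_eq_zero, eval_of] at h0
  have h1 : eval (FreeAbelianGroup.lift (fun s : (Σ n, IntegralRep n) => of (P s.1 s.2)) (of r)) =
      (P n r).value := by
    have e : FreeAbelianGroup.lift (fun s : (Σ n, IntegralRep n) => of (P s.1 s.2)) (of r) =
        of (P n r) := FreeAbelianGroup.lift_apply_of _ _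
    rw [e, eval_of]
  rw [h1] at h0
  exact h0.symm

/-- **Iterates of a pinned family on a generator**: one generator, dimension raised by `2N`, value
multiplied by `π ^ N`. [folklore] -/
theorem lift_iterate_of (P : ∀ n : ℕ, IntegralRep n → IntegralRep (n + 2))
    (hP : ∀ (n : ℕ) (r : IntegralRep n),
      (P n r).domain = {z : Fin (n + 2) → ℝ | z 0 ^ 2 + z 1 ^ 2 ≤ 1 ∧
          (fun i : Fin n => z i.succ.succ) ∈ r.domain} ∧
        (P n r).integrand = fun z => r.integrand (fun i : Fin n => z i.succ.succ))
    (N : ℕ) (s : Σ n, IntegralRep n) :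
    ∃ t : Σ n, IntegralRep n, t.1 = s.1 + 2 * N ∧ t.2.value = Real.pi ^ N * s.2.value ∧
      (⇑(FreeAbelianGroup.lift (fun s : (Σ n, IntegralRep n) => of (P s.1 s.2))))^[N]
        (FreeAbelianGroup.of s) = FreeAbelianGroup.of t := by
  induction N with
  | zero => exact ⟨s, by simp, by simp, rfl⟩
  | succ N ih =>
    obtain ⟨t, ht1, ht2, ht3⟩ := ih
    refine ⟨⟨t.1 + 2, P t.1 t.2⟩, by show t.1 + 2 = s.1 + 2 * (N + 1); rw [ht1]; ring, ?_, ?_⟩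
    · show (P t.1 t.2).value = _
      rw [value_pinned P hP, ht2, pow_succ]
      ring
    · rw [Function.iterate_succ_apply', ht3, FreeAbelianGroup.lift_apply_of]
      rfl

/-- **Newton–Leibniz is load-bearing even `[π]`-locally.** The crux with `KZ.relations` replaced by
the sub-calculus generated by (1a), (1b), (2) is FALSE: the witness `c = [ℝ⁰ × [0,1], 1] − [ℝ⁰, 1]`
is one rule-(3) move (so `c ∈ KZ.relations`, value `0`), but the graded evaluation in dimension `2N`
of `(lift (of ∘ P))^[N] c` is `−π ^ N ≠ 0` (the disc-powers of `[ℝ⁰, 1]` live in dimension `2N`,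
those of the slab in dimension `2N + 1`). [folklore] -/
theorem not_piLocalKernel_noNL :
    ¬ ∀ P : ∀ n : ℕ, IntegralRep n → IntegralRep (n + 2),
      (∀ (n : ℕ) (r : IntegralRep n),
        (P n r).domain = {z : Fin (n + 2) → ℝ | z 0 ^ 2 + z 1 ^ 2 ≤ 1 ∧
            (fun i : Fin n => z i.succ.succ) ∈ r.domain} ∧
          (P n r).integrand = fun z => r.integrand (fun i : Fin n => z i.succ.succ)) →
      ∀ c : FormalRep, eval c = 0 → ∃ N : ℕ,
        (⇑(FreeAbelianGroup.lift (fun s : (Σ n, IntegralRep n) => of (P s.1 s.2))))^[N] c ∈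
          AddSubgroup.closure (domainAddRel ∪ integrandAddRel ∪ changeOfVariablesRel) := by
  intro h
  obtain ⟨P, hP⟩ := exists_pinned
  -- the unit constant `[ℝ⁰, 1]` and its slab `[ℝ⁰ × [0,1], 1]`
  let u : IntegralRep 0 := IntegralRep.ofRational univ 1 1
    Literature.ModelTheory.ExponentialFields.isSemialgebraic_univ (fun _ _ => by simp) (by simp)
  have hu : u.value = 1 := by
    simp only [u, IntegralRep.value_ofRational]
    simp [Measure.real, volume_pi]
  have hc : of (u.slab 0) - of u ∈ relations :=
    newtonLeibnizRel_subset_relations (u.of_slab_sub_of_mem_newtonLeibnizRel 0)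
  have h0 : eval (of (u.slab 0) - of u) = 0 := relations_le_ker_eval_holds hc
  obtain ⟨N, hN⟩ := h P hP _ h0
  have h1 : FreeAbelianGroup.lift
      (fun s : (Σ n, IntegralRep n) => if s.1 = 0 + 2 * N then s.2.value else (0 : ℝ))
      ((⇑(FreeAbelianGroup.lift (fun s : (Σ n, IntegralRep n) => of (P s.1 s.2))))^[N]
        (of (u.slab 0) - of u)) = 0 :=
    closure_noNL_le_ker_gradedEval _ hN
  obtain ⟨t₁, ht₁, -, e₁⟩ := lift_iterate_of P hP N ⟨1, u.slab 0⟩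
  obtain ⟨t₀, ht₀, hv₀, e₀⟩ := lift_iterate_of P hP N ⟨0, u⟩
  dsimp only at ht₁ ht₀ hv₀
  have e : (⇑(FreeAbelianGroup.lift (fun s : (Σ n, IntegralRep n) => of (P s.1 s.2))))^[N]
      (of (u.slab 0) - of u) = FreeAbelianGroup.of t₁ - FreeAbelianGroup.of t₀ := by
    rw [← e₁, ← e₀]
    exact iterate_map_sub _ N _ _
  rw [e, map_sub, FreeAbelianGroup.lift_apply_of, FreeAbelianGroup.lift_apply_of,
    if_neg (show t₁.1 ≠ 0 + 2 * N by rw [ht₁]; omega), if_pos ht₀, hv₀, zero_sub, neg_eq_zero] at h1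
  -- `h1 : π ^ N * value [ℝ⁰, 1] = 0`, absurd since `π ≠ 0`
  simp [hu] at h1

end Summit.KontsevichZagierPeriods.LiouvilleUnfolding.AyoubPiLocalKernelNegative.Subcalculi

end
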